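import Literature.NumberTheory.GaloisRepresentations.SerreSL2Lifting
import HarnessLib

/-!
# Lifting with a transvection: a subgroup of `SL₂(ℤ/p^N ℤ)` mapping onto `SL₂(𝔽_p)` and
# containing `(1 1; 0 1)` is everything — for every prime `p`

Topic `NumberTheory/GaloisRepresentations`; theorems only (no definitions, no named facts),
Mathlib plus the tree file `SerreSL2Lifting` (J.-P. Serre, *Abelian `ℓ`-adic representations and
elliptic curves* (1968), Ch. IV §3.4, Lemma 3; S. Lang, *Elliptic Functions* (1987), Ch. 17 §4,
Lemma), whose finite-level statement `Serre1968.specialLinearGroup_eq_top_of_map_surjective`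
("`H ≤ SL₂(ℤ/p^N ℤ)` onto `SL₂(𝔽_p)` ⟹ `H = SL₂(ℤ/p^N ℤ)`") needs `p ≥ 5` — and is false for
`p = 2, 3` (N. Elkies, *Elliptic curves with 3-adic Galois representation surjective mod 3 but not
mod 9*, arXiv:math/0612734). This file proves the variant valid for **every** prime `p`, in which
the missing `p`-th power trick is replaced by one extra generator:

* `TransvectionLifting.specialLinearGroup_eq_top_of_transvection_mem` — for a prime `p`, `N ≠ 0`
  and a subgroup `H ≤ SL₂(ℤ/p^N ℤ)` whose reduction modulo `p` is all of `SL₂(𝔽_p)` and which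
  contains the transvection `T = (1 1; 0 1)`, `H = SL₂(ℤ/p^N ℤ)`;
* `TransvectionLifting.toGL_mem_of_transvection_mem` — the same for `H ≤ GL₂(ℤ/p^N ℤ)` whose
  reduction contains `SL₂(𝔽_p)`: then `H ⊇ SL₂(ℤ/p^N ℤ)`;
* `TransvectionLifting.generalLinearGroup_eq_top_of_transvection_mem` — if moreover
  `det : H → (ℤ/p^N ℤ)ˣ` is onto then `H = GL₂(ℤ/p^N ℤ)`;
* `TransvectionLifting.generalLinearGroup_eq_top_of_conj_transvection_mem`,
  `TransvectionLifting.generalLinearGroup_eq_top_of_unipotent_mem` — the forms used for the image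
  of Galois: `H ≤ GL₂(ℤ/p^N ℤ)` mapping onto `GL₂(𝔽_p)`, with `det` onto, and containing a
  conjugate `g T g⁻¹` of `T`, equivalently an element `u` with `(u - 1)² = 0` and
  `u ≢ 1 (mod p)`, is everything.

The intended arithmetic application (hypothesis (ram) of Burungale–Skinner–Tian–Wan,
arXiv:2409.01350, Thm. 1.10, tree fact
`Literature.NumberTheory.EllipticCurves.burungaleSkinnerTianWan_analyticRank_eq_one_of_selmerCorank_eq_one`):
for an elliptic curve `E/ℚ` with a prime `ℓ ‖ N` at which `ρ̄_{E,p}` is ramified, the inertia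
group at `ℓ` acts on `E[p^N]` through `(1 *; 0 1)` with `*` onto `ℤ/p^N ℤ` (Tate curve), so the
image of `ρ̄_{E,p^N}` contains a conjugate of `T`; hence `ρ̄_{E,p}` onto ⟹ `ρ̄_{E,p^N}` onto for
**all** `p`, including `p = 3`, where surjectivity modulo `3` alone does not lift (Elkies,
loc. cit.).

## Proof

Steps (1), (3), (4) are those of `Serre1968.specialLinearGroup_eq_top_of_map_surjective`
(Lang, loc. cit.), verbatim: (1) every `s ∈ SL₂(ℤ/p^N)` is `≡ h (mod p)` for some `h ∈ H`;
(3) an element `u = 1 + p^k Z` of `SL₂` (`1 ≤ k < N`) has `p ∣ tr Z`, so `Z` is modulo `p` the sum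
of the three nilpotents `(0, b; 0, 0)`, `(0, 0; c, 0)`, `(a, a; -a, -a)`, and `u` is reached
modulo `p^{k+1}` by a product of three elements of `H` congruent to `1 + p^k ·` (nilpotent);
(4) induction on `k`. Step (2) — reaching `1 + p^k w (mod p^{k+1})` for the three nilpotents `w` —
is where Serre and Lang raise to `p`-th powers (`p ≥ 5`); here instead (2′): `T^{p^k a} =
1 + p^k a E₁₂` exactly, and for `h ∈ H` with `h ≡ g (mod p)`,
`h T^{p^k a} h⁻¹ = 1 + p^k a · h E₁₂ h⁻¹ ≡ 1 + p^k a · g E₁₂ g⁻¹ (mod p^{k+1})`; with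
`g = 1`, `g = (0 -1; 1 0)` and `g = (1 0; -1 1)` the conjugate `g E₁₂ g⁻¹` is `(0 1; 0 0)`,
`(0 0; -1 0)` and `(1 1; -1 -1)` respectively. For the `GL₂` form, the elements of `H` of
determinant `1` form a subgroup `H₁ ≤ SL₂(ℤ/p^N ℤ)` containing `T` and `x T^m x⁻¹` for `x ∈ H`
with `x ≡ (0 -1; 1 0) (mod p)`, whose reductions are all upper and lower elementary transvections
of `SL₂(𝔽_p)`; these generate `SL₂(𝔽_p)` (Mathlib `Matrix.SL2.transvection_induction`), so (1)
holds for `H₁`. (Serre's and Lang's route through the commutator subgroup needs `SL₂(𝔽_p)`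
perfect, i.e. `p ≥ 5`.) Finally an element `u` with `(u-1)² = 0`, `u ≢ 1 (mod p)` is conjugate in
`GL₂(ℤ/p^N ℤ)` to `T`: `n = u - 1` has a unit off-diagonal entry (if both were `≡ 0` then
`n² = 0` would force the diagonal `≡ 0` too), and `n P = P E₁₂` for `P = (n e₂ | e₂)`, resp.
`P = (n e₁ | e₁)`, which is invertible.

## Design notes

* Same conventions as `SerreSL2Lifting`: everything for `Matrix.SpecialLinearGroup (Fin 2)
  (ZMod (p ^ N))` / `Matrix.GeneralLinearGroup (Fin 2) (ZMod (p ^ N))`, reduction maps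
  `Matrix.SpecialLinearGroup.map` / `Matrix.GeneralLinearGroup.map` of
  `ZMod.castHom (dvd_pow_self p hN) (ZMod p)`, congruences as `∃ C, x = y + q^k • C`; the helper
  lemmas of `Serre1968` (`exists_eq_add_smul_of_map_eq`, `exists_trace_eq_mul`, `eq_add_nilpotents`,
  `exists_mul_mul_eq_one_add_of_one_le`, …) are reused, not restated.
* The transvection is Mathlib's `Matrix.SpecialLinearGroup.transvection (0 ≠ 1) 1`.
* Namespace `Literature.NumberTheory.GaloisRepresentations.TransvectionLifting`.
* What is NOT here: the `p`-adic statement about closed subgroups of `SL₂(ℤ_p)` (the conjunction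
  over `N`), and the arithmetic input (Tate curve), which lives with the elliptic-curve files.

## References

* [SerreAbelianLadic1968] J.-P. Serre, *Abelian `ℓ`-adic representations and elliptic curves*
  (1968), Ch. IV §3.4, Lemma 3 (finite level: tree `SerreSL2Lifting`).
* [Lang1987] S. Lang, *Elliptic Functions*, 2nd ed., GTM 112 (1987), Ch. 17 §4, Lemma and proof
  (held: `book:lang1987-elliptic-functions`, pp. 178–179).
* [Elkies2006] N. D. Elkies, *Elliptic curves with 3-adic Galois representation surjective mod 3
  but not mod 9*, arXiv:math/0612734 (2006) (why `p ≥ 5` is needed without the transvection).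
-/

open scoped MatrixGroups

namespace Literature.NumberTheory.GaloisRepresentations.TransvectionLifting

open Matrix Serre1968

/-! ### Small matrix identities over a commutative ring -/

section Matrices

variable {R : Type*} [CommRing R]

/-- `single 0 1 a = (0 a; 0 0)`. [folklore] -/
theorem single_zero_one_eq (a : R) : (Matrix.single 0 1 a : Matrix (Fin 2) (Fin 2) R) = !![0, a; 0, 0] := by
  ext i j
  fin_cases i <;> fin_cases j <;> simp [Matrix.single]

/-- Powers of the transvection: `(1 + b E_{ij})^m = 1 + m b E_{ij}`. [folklore] -/
theorem transvection_pow {i j : Fin 2} (hij : i ≠ j) (b : R) (m : ℕ) :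
    SpecialLinearGroup.transvection hij b ^ m = SpecialLinearGroup.transvection hij ((m : R) * b) := by
  induction m with
  | zero => rw [pow_zero, Nat.cast_zero, zero_mul, SpecialLinearGroup.transvection_coeff_zero]
  | succ m ih =>
    rw [pow_succ, ih, Nat.cast_succ, add_mul, one_mul, SpecialLinearGroup.transvection_add]

/-- The matrix of `T^m`, `T = (1 1; 0 1)`: `1 + (0 m; 0 0)`. [folklore] -/
theorem coe_transvection_one_pow (m : ℕ) :
    ((SpecialLinearGroup.transvection (zero_ne_one : (0 : Fin 2) ≠ 1) (1 : R) ^ m :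
      SL(2, R)) : Matrix (Fin 2) (Fin 2) R) = 1 + !![(0 : R), m; 0, 0] := by
  rw [transvection_pow, mul_one, SpecialLinearGroup.transvection_coe, single_zero_one_eq]

/-- Reduction of a transvection along a ring homomorphism. [folklore] -/
theorem map_transvection {S : Type*} [CommRing S] (f : R →+* S) {i j : Fin 2} (hij : i ≠ j)
    (b : R) :
    SpecialLinearGroup.map f (SpecialLinearGroup.transvection hij b) =
      SpecialLinearGroup.transvection hij (f b) := by
  apply Subtype.ext
  rw [SpecialLinearGroup.map_apply_coe, RingHom.mapMatrix_apply,
    SpecialLinearGroup.transvection_coe, SpecialLinearGroup.transvection_coe]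
  ext i' j'
  fin_cases i <;> fin_cases j <;> fin_cases i' <;> fin_cases j' <;>
    first | exact absurd rfl hij | simp [Matrix.single]

/-- For `2 × 2` matrices the adjugate is additive. [folklore] -/
theorem adjugate_add_smul (X Y : Matrix (Fin 2) (Fin 2) R) (c : R) :
    adjugate (X + c • Y) = adjugate X + c • adjugate Y := by
  rw [adjugate_fin_two, adjugate_fin_two, adjugate_fin_two]
  ext i j
  fin_cases i <;> fin_cases j <;> simp <;> ring

/-- The rotation `J = (0 -1; 1 0)` as an element of `SL₂`. [folklore] -/
theorem det_J : Matrix.det !![(0 : R), -1; 1, 0] = 1 := by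
  simp [Matrix.det_fin_two_of]

/-- The lower unipotent `G = (1 0; -1 1)` has determinant `1`. [folklore] -/
theorem det_G : Matrix.det !![(1 : R), 0; -1, 1] = 1 := by
  simp [Matrix.det_fin_two_of]

/-- `J (0 a; 0 0) J⁻¹ = (0 0; -a 0)`. [folklore] -/
theorem J_conj_upper (a : R) :
    !![(0 : R), -1; 1, 0] * !![0, a; 0, 0] * adjugate !![(0 : R), -1; 1, 0] = !![0, 0; -a, 0] := by
  rw [adjugate_fin_two]
  ext i j
  fin_cases i <;> fin_cases j <;> simp [Matrix.mul_apply, Fin.sum_univ_two]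

/-- `G (0 a; 0 0) G⁻¹ = (a a; -a -a)` for `G = (1 0; -1 1)`. [folklore] -/
theorem G_conj_upper (a : R) :
    !![(1 : R), 0; -1, 1] * !![0, a; 0, 0] * adjugate !![(1 : R), 0; -1, 1] = !![a, a; -a, -a] := by
  rw [adjugate_fin_two]
  ext i j
  fin_cases i <;> fin_cases j <;> simp [Matrix.mul_apply, Fin.sum_univ_two]

/-- `J (0 m; 0 0) J⁻¹ = - m E₂₁` in `SL₂` form: for `J = (0 -1; 1 0)`, `J T^m J⁻¹` is the lower
transvection with parameter `-m`. [folklore] -/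
theorem J_mul_transvection_pow_mul_J_inv (J : SL(2, R))
    (hJ : (J : Matrix (Fin 2) (Fin 2) R) = !![0, -1; 1, 0]) (m : ℕ) :
    J * SpecialLinearGroup.transvection (zero_ne_one : (0 : Fin 2) ≠ 1) (1 : R) ^ m * J⁻¹ =
      SpecialLinearGroup.transvection (one_ne_zero : (1 : Fin 2) ≠ 0) (-(m : R)) := by
  apply Subtype.ext
  rw [SpecialLinearGroup.coe_mul, SpecialLinearGroup.coe_mul, SpecialLinearGroup.coe_inv,
    coe_transvection_one_pow, SpecialLinearGroup.transvection_coe, hJ, adjugate_fin_two]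
  have e1 : (1 : Matrix (Fin 2) (Fin 2) R) + !![0, (m : R); 0, 0] = !![1, (m : R); 0, 1] := by
    ext i j; fin_cases i <;> fin_cases j <;> simp
  have e2 : (1 : Matrix (Fin 2) (Fin 2) R) + Matrix.single 1 0 (-(m : R)) =
      !![1, 0; -(m : R), 1] := by
    ext i j; fin_cases i <;> fin_cases j <;> simp [Matrix.single]
  rw [e1, e2]
  ext i j
  fin_cases i <;> fin_cases j <;> simp [Matrix.mul_apply, Fin.sum_univ_two]

end Matrices

/-! ### Units of `ℤ/p^N ℤ` versus reduction modulo `p` -/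

section ZMod

variable {p N : ℕ} [Fact p.Prime]

/-- An element of `ℤ/p^N ℤ` with nonzero reduction modulo `p` is a unit. [folklore] -/
theorem isUnit_of_cast_ne_zero (hN : N ≠ 0) {b : ZMod (p ^ N)}
    (hb : ZMod.castHom (dvd_pow_self p hN) (ZMod p) b ≠ 0) : IsUnit b := by
  have hp : p.Prime := Fact.out
  haveI : NeZero (p ^ N) := ⟨pow_ne_zero N hp.ne_zero⟩
  rw [← ZMod.natCast_zmod_val b]
  apply (ZMod.isUnit_iff_coprime b.val (p ^ N)).mpr
  apply Nat.Coprime.pow_right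
  rw [Nat.coprime_comm, hp.coprime_iff_not_dvd]
  intro hdvd
  apply hb
  rw [ZMod.castHom_apply, ZMod.cast_eq_val, (ZMod.natCast_eq_zero_iff _ _).mpr hdvd]

end ZMod

/-! ### The `SL₂` statement -/

section Main

variable {p N : ℕ} [Fact p.Prime]

set_option maxHeartbeats 800000 in
/-- **Lifting with a transvection, `SL₂` form.** For a prime `p` (any prime, including `2` and
`3`), `N ≠ 0` and a subgroup `H ≤ SL₂(ℤ/p^N ℤ)` such that every element of `SL₂(𝔽_p)` is the
reduction of an element of `H` and `T = (1 1; 0 1) ∈ H`, `H = SL₂(ℤ/p^N ℤ)`. Steps (1), (3), (4)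
of Serre's Lemma 3 / Lang's Lemma (`Serre1968.specialLinearGroup_eq_top_of_map_surjective`)
with step (2) replaced by conjugating `T^{p^k a} = 1 + p^k a E₁₂` (module docstring).
[cite: SerreAbelianLadic1968, Ch. IV §3.4, Lemma 3 (steps of the proof)]
[cite: Lang1987, Ch. 17 §4, Lemma (proof)] -/
theorem specialLinearGroup_eq_top_of_transvection_mem (hN : N ≠ 0)
    (H : Subgroup SL(2, ZMod (p ^ N)))
    (hH : ∀ t : SL(2, ZMod p), ∃ h ∈ H,
      SpecialLinearGroup.map (ZMod.castHom (dvd_pow_self p hN) (ZMod p)) h = t)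
    (hT : SpecialLinearGroup.transvection (zero_ne_one : (0 : Fin 2) ≠ 1) (1 : ZMod (p ^ N)) ∈ H) :
    H = ⊤ := by
  have hp : p.Prime := Fact.out
  set T : SL(2, ZMod (p ^ N)) :=
    SpecialLinearGroup.transvection (zero_ne_one : (0 : Fin 2) ≠ 1) (1 : ZMod (p ^ N)) with hTdef
  -- Step 1: every `s` is congruent modulo `p` to an element of `H`.
  have step1 : ∀ s : SL(2, ZMod (p ^ N)), ∃ h ∈ H, ∃ C : Matrix (Fin 2) (Fin 2) (ZMod (p ^ N)),
      (h : Matrix (Fin 2) (Fin 2) (ZMod (p ^ N))) =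
        (s : Matrix (Fin 2) (Fin 2) (ZMod (p ^ N))) + (p : ZMod (p ^ N)) • C := by
    intro s
    obtain ⟨h, hh, hred⟩ :=
      hH (SpecialLinearGroup.map (ZMod.castHom (dvd_pow_self p hN) (ZMod p)) s)
    refine ⟨h, hh, exists_eq_add_smul_of_map_eq hN _ _ ?_⟩
    have := congrArg (fun g : SL(2, ZMod p) ↦ (g : Matrix (Fin 2) (Fin 2) (ZMod p))) hred
    simpa only [SpecialLinearGroup.map_apply_coe, RingHom.mapMatrix_apply] using this
  -- Step 2′: conjugates of `T^(p^k a)` reach `1 + p^k a · g E₁₂ g⁻¹` modulo `p^(k+1)`.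
  have step2 : ∀ (g : SL(2, ZMod (p ^ N))) (a : ZMod (p ^ N)) (k : ℕ),
      ∃ h ∈ H, ∃ C : Matrix (Fin 2) (Fin 2) (ZMod (p ^ N)),
        (h : Matrix (Fin 2) (Fin 2) (ZMod (p ^ N))) =
          1 + ((p : ZMod (p ^ N)) ^ k) •
              ((g : Matrix (Fin 2) (Fin 2) (ZMod (p ^ N))) * !![0, a; 0, 0] *
                adjugate (g : Matrix (Fin 2) (Fin 2) (ZMod (p ^ N)))) +
            ((p : ZMod (p ^ N)) ^ (k + 1)) • C := by
    intro g a k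
    haveI : NeZero (p ^ N) := ⟨pow_ne_zero N hp.ne_zero⟩
    obtain ⟨x, hx, C₁, hC₁⟩ := step1 g
    -- the power of `T`
    set m : ℕ := p ^ k * a.val with hm
    have hTm : ((T ^ m : SL(2, ZMod (p ^ N))) : Matrix (Fin 2) (Fin 2) (ZMod (p ^ N))) =
        1 + ((p : ZMod (p ^ N)) ^ k) • !![0, a; 0, 0] := by
      rw [hTdef, coe_transvection_one_pow, hm, Nat.cast_mul, Nat.cast_pow, ZMod.natCast_zmod_val]
      congr 1
      ext i j
      fin_cases i <;> fin_cases j <;> simp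
    -- the inverse of `x` modulo `p`
    have hxinv : ((x⁻¹ : SL(2, ZMod (p ^ N))) : Matrix (Fin 2) (Fin 2) (ZMod (p ^ N))) =
        adjugate (g : Matrix (Fin 2) (Fin 2) (ZMod (p ^ N))) + (p : ZMod (p ^ N)) • adjugate C₁ := by
      rw [SpecialLinearGroup.coe_inv, hC₁, adjugate_add_smul]
    have hxx : (x : Matrix (Fin 2) (Fin 2) (ZMod (p ^ N))) *
        ((x⁻¹ : SL(2, ZMod (p ^ N))) : Matrix (Fin 2) (Fin 2) (ZMod (p ^ N))) = 1 := by
      rw [← SpecialLinearGroup.coe_mul, mul_inv_cancel, SpecialLinearGroup.coe_one]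
    refine ⟨x * T ^ m * x⁻¹, H.mul_mem (H.mul_mem hx (H.pow_mem hT m)) (H.inv_mem hx),
      C₁ * !![0, a; 0, 0] * adjugate (g : Matrix (Fin 2) (Fin 2) (ZMod (p ^ N))) +
        (g : Matrix (Fin 2) (Fin 2) (ZMod (p ^ N))) * !![0, a; 0, 0] * adjugate C₁ +
        (p : ZMod (p ^ N)) • (C₁ * !![0, a; 0, 0] * adjugate C₁), ?_⟩
    rw [SpecialLinearGroup.coe_mul, SpecialLinearGroup.coe_mul, hTm]
    have key : (x : Matrix (Fin 2) (Fin 2) (ZMod (p ^ N))) *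
        (1 + ((p : ZMod (p ^ N)) ^ k) • !![0, a; 0, 0]) *
          ((x⁻¹ : SL(2, ZMod (p ^ N))) : Matrix (Fin 2) (Fin 2) (ZMod (p ^ N))) =
        1 + ((p : ZMod (p ^ N)) ^ k) • ((x : Matrix (Fin 2) (Fin 2) (ZMod (p ^ N))) * !![0, a; 0, 0] *
          ((x⁻¹ : SL(2, ZMod (p ^ N))) : Matrix (Fin 2) (Fin 2) (ZMod (p ^ N)))) := by
      rw [mul_add, mul_one, add_mul, hxx, mul_smul_comm, smul_mul_assoc]
    rw [key, hxinv, hC₁]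
    simp only [add_mul, mul_add, smul_mul_assoc, mul_smul_comm, smul_add, smul_smul]
    module
  -- Step 2″: the three nilpotent shapes.
  have step2u : ∀ (a : ZMod (p ^ N)) (k : ℕ), ∃ h ∈ H, ∃ C : Matrix (Fin 2) (Fin 2) (ZMod (p ^ N)),
      (h : Matrix (Fin 2) (Fin 2) (ZMod (p ^ N))) =
        1 + ((p : ZMod (p ^ N)) ^ k) • !![0, a; 0, 0] + ((p : ZMod (p ^ N)) ^ (k + 1)) • C := by
    intro a k
    obtain ⟨h, hh, C, hC⟩ := step2 1 a k
    refine ⟨h, hh, C, ?_⟩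
    rw [hC, SpecialLinearGroup.coe_one, adjugate_one, one_mul, mul_one]
  have step2l : ∀ (b : ZMod (p ^ N)) (k : ℕ), ∃ h ∈ H, ∃ C : Matrix (Fin 2) (Fin 2) (ZMod (p ^ N)),
      (h : Matrix (Fin 2) (Fin 2) (ZMod (p ^ N))) =
        1 + ((p : ZMod (p ^ N)) ^ k) • !![0, 0; b, 0] + ((p : ZMod (p ^ N)) ^ (k + 1)) • C := by
    intro b k
    obtain ⟨h, hh, C, hC⟩ := step2 ⟨!![0, -1; 1, 0], det_J⟩ (-b) k
    refine ⟨h, hh, C, ?_⟩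
    rw [hC]
    change 1 + (p : ZMod (p ^ N)) ^ k • (!![(0 : ZMod (p ^ N)), -1; 1, 0] * !![0, -b; 0, 0] *
      adjugate !![(0 : ZMod (p ^ N)), -1; 1, 0]) + _ = _
    rw [J_conj_upper, neg_neg]
  have step2t : ∀ (c : ZMod (p ^ N)) (k : ℕ), ∃ h ∈ H, ∃ C : Matrix (Fin 2) (Fin 2) (ZMod (p ^ N)),
      (h : Matrix (Fin 2) (Fin 2) (ZMod (p ^ N))) =
        1 + ((p : ZMod (p ^ N)) ^ k) • !![c, c; -c, -c] + ((p : ZMod (p ^ N)) ^ (k + 1)) • C := by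
    intro c k
    obtain ⟨h, hh, C, hC⟩ := step2 ⟨!![1, 0; -1, 1], det_G⟩ c k
    refine ⟨h, hh, C, ?_⟩
    rw [hC]
    change 1 + (p : ZMod (p ^ N)) ^ k • (!![(1 : ZMod (p ^ N)), 0; -1, 1] * !![0, c; 0, 0] *
      adjugate !![(1 : ZMod (p ^ N)), 0; -1, 1]) + _ = _
    rw [G_conj_upper]
  -- Step 3: the kernel of reduction modulo `p^k` is reached modulo `p^(k+1)` (`1 ≤ k < N`).
  have step3 : ∀ k, 1 ≤ k → k < N →
      ∀ (u : SL(2, ZMod (p ^ N))) (Z : Matrix (Fin 2) (Fin 2) (ZMod (p ^ N))),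
        (u : Matrix (Fin 2) (Fin 2) (ZMod (p ^ N))) = 1 + ((p : ZMod (p ^ N)) ^ k) • Z →
        ∃ h ∈ H, ∃ C : Matrix (Fin 2) (Fin 2) (ZMod (p ^ N)),
          (h : Matrix (Fin 2) (Fin 2) (ZMod (p ^ N))) = u + ((p : ZMod (p ^ N)) ^ (k + 1)) • C := by
    intro k hk hkN u Z hu
    have hdet : (1 + ((p : ZMod (p ^ N)) ^ k) • Z).det = 1 := by rw [← hu]; exact u.det_coe
    obtain ⟨t, ht⟩ := exists_trace_eq_mul hk hkN Z hdet
    obtain ⟨h₁, hh₁, C₁, hC₁⟩ := step2u (Z 0 1 - Z 0 0) k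
    obtain ⟨h₂, hh₂, C₂, hC₂⟩ := step2l (Z 1 0 + Z 0 0) k
    obtain ⟨h₃, hh₃, C₃, hC₃⟩ := step2t (Z 0 0) k
    obtain ⟨V, hV⟩ := exists_mul_mul_eq_one_add_of_one_le (p : ZMod (p ^ N)) hk
      !![0, Z 0 1 - Z 0 0; 0, 0] !![0, 0; Z 1 0 + Z 0 0, 0] !![Z 0 0, Z 0 0; -Z 0 0, -Z 0 0]
      C₁ C₂ C₃
    refine ⟨h₁ * h₂ * h₃, H.mul_mem (H.mul_mem hh₁ hh₂) hh₃, V - !![0, 0; 0, t], ?_⟩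
    have hZ : ((p : ZMod (p ^ N)) ^ k) • Z =
        ((p : ZMod (p ^ N)) ^ k) • (!![0, Z 0 1 - Z 0 0; 0, 0] + !![0, 0; Z 1 0 + Z 0 0, 0] +
          !![Z 0 0, Z 0 0; -Z 0 0, -Z 0 0]) + ((p : ZMod (p ^ N)) ^ (k + 1)) • !![0, 0; 0, t] := by
      conv_lhs => rw [eq_add_nilpotents Z t ht]
      rw [smul_add _ (_ + _ + _) (_ • _), smul_smul, ← pow_succ]
    rw [SpecialLinearGroup.coe_mul, SpecialLinearGroup.coe_mul, hC₁, hC₂, hC₃, hV, hu, hZ,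
      smul_sub]
    abel
  -- Step 4: every `s` is congruent modulo `p^k` to an element of `H`, for every `k ≥ 1`.
  have step4 : ∀ k, 1 ≤ k → ∀ s : SL(2, ZMod (p ^ N)), ∃ h ∈ H,
      ∃ C : Matrix (Fin 2) (Fin 2) (ZMod (p ^ N)),
        (h : Matrix (Fin 2) (Fin 2) (ZMod (p ^ N))) =
          (s : Matrix (Fin 2) (Fin 2) (ZMod (p ^ N))) + ((p : ZMod (p ^ N)) ^ k) • C := by
    intro k hk
    induction k, hk using Nat.le_induction with
    | base => simpa only [pow_one] using step1
    | succ k hk ih =>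
      intro s
      obtain ⟨h₀, hh₀, C, hC⟩ := ih s
      by_cases hkN : k < N
      · have hu : ((s * h₀⁻¹ : SL(2, ZMod (p ^ N))) : Matrix (Fin 2) (Fin 2) (ZMod (p ^ N))) =
            1 + ((p : ZMod (p ^ N)) ^ k) •
              (-(C * ((h₀⁻¹ : SL(2, ZMod (p ^ N))) : Matrix (Fin 2) (Fin 2) (ZMod (p ^ N))))) := by
          have h1 :
              ((h₀ * h₀⁻¹ : SL(2, ZMod (p ^ N))) : Matrix (Fin 2) (Fin 2) (ZMod (p ^ N))) = 1 := by
            rw [mul_inv_cancel, SpecialLinearGroup.coe_one]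
          rw [SpecialLinearGroup.coe_mul] at h1 ⊢
          have hs :
              (s : Matrix (Fin 2) (Fin 2) (ZMod (p ^ N))) = h₀ - ((p : ZMod (p ^ N)) ^ k) • C := by
            rw [hC]; abel
          rw [hs, sub_mul, h1, smul_mul_assoc, smul_neg, sub_eq_add_neg]
        obtain ⟨h₁, hh₁, C', hC'⟩ := step3 k hk hkN (s * h₀⁻¹) _ hu
        refine ⟨h₁ * h₀, H.mul_mem hh₁ hh₀, C' * (h₀ : Matrix (Fin 2) (Fin 2) (ZMod (p ^ N))), ?_⟩
        rw [SpecialLinearGroup.coe_mul, hC', add_mul, ← SpecialLinearGroup.coe_mul,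
          inv_mul_cancel_right, smul_mul_assoc]
      · refine ⟨h₀, hh₀, 0, ?_⟩
        rw [hC, natCast_pow_eq_zero_of_le (show N ≤ k by omega),
          natCast_pow_eq_zero_of_le (show N ≤ k + 1 by omega), zero_smul, zero_smul]
  -- Conclusion: modulo `p^N` congruence is equality.
  rw [eq_top_iff]
  intro s _
  obtain ⟨h, hh, C, hC⟩ := step4 N (Nat.one_le_iff_ne_zero.mpr hN) s
  rw [natCast_pow_eq_zero, zero_smul, add_zero] at hC
  have : h = s := Subtype.ext hC
  exact this ▸ hh

end Main

/-! ### The `GL₂` statements -/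

section GeneralLinear

variable {p N : ℕ} [Fact p.Prime]

/-- A subgroup of `SL₂` over a field containing all upper and all lower elementary transvections
is everything (Mathlib `Matrix.SL2.transvection_induction`). [folklore] -/
theorem specialLinearGroup_eq_top_of_transvections_mem {F : Type*} [Field F]
    (S : Subgroup SL(2, F))
    (hu : ∀ c : F, SpecialLinearGroup.transvection (zero_ne_one : (0 : Fin 2) ≠ 1) c ∈ S)
    (hl : ∀ c : F, SpecialLinearGroup.transvection (one_ne_zero : (1 : Fin 2) ≠ 0) c ∈ S) :
    S = ⊤ := by
  rw [eq_top_iff]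
  intro A _
  refine Matrix.SL2.transvection_induction (fun B ↦ B ∈ S) (fun i j hij c ↦ ?_)
    (fun _ _ hA hB ↦ S.mul_mem hA hB) A
  fin_cases i <;> fin_cases j
  · exact absurd rfl hij
  · exact hu c
  · exact hl c
  · exact absurd rfl hij

set_option maxHeartbeats 400000 in
/-- **Lifting with a transvection, `GL₂` form.** For a prime `p`, `N ≠ 0` and a subgroup
`H ≤ GL₂(ℤ/p^N ℤ)` whose reduction modulo `p` contains `SL₂(𝔽_p)` and which contains
`T = (1 1; 0 1)`, every element of `SL₂(ℤ/p^N ℤ)` lies in `H`. Proof: the elements of `H` of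
determinant `1` form a subgroup `H₁ ≤ SL₂(ℤ/p^N ℤ)` containing `T` and the conjugates
`x T^m x⁻¹`, `x ∈ H` with `x ≡ (0 -1; 1 0) (mod p)`; their reductions are all the upper and lower
elementary transvections, which generate `SL₂(𝔽_p)`, so
`specialLinearGroup_eq_top_of_transvection_mem` applies to `H₁`.
[cite: Lang1987, Ch. 17 §4, Lemma (proof)] -/
theorem toGL_mem_of_transvection_mem (hN : N ≠ 0)
    (H : Subgroup (GL (Fin 2) (ZMod (p ^ N))))
    (hH : ∀ t : SL(2, ZMod p), ∃ h ∈ H,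
      GeneralLinearGroup.map (ZMod.castHom (dvd_pow_self p hN) (ZMod p)) h =
        (t : GL (Fin 2) (ZMod p)))
    (hT : ((SpecialLinearGroup.transvection (zero_ne_one : (0 : Fin 2) ≠ 1) (1 : ZMod (p ^ N)) :
      SL(2, ZMod (p ^ N))) : GL (Fin 2) (ZMod (p ^ N))) ∈ H)
    (s : SL(2, ZMod (p ^ N))) : (s : GL (Fin 2) (ZMod (p ^ N))) ∈ H := by
  have hp : p.Prime := Fact.out
  haveI : NeZero (p ^ N) := ⟨pow_ne_zero N hp.ne_zero⟩
  set T : SL(2, ZMod (p ^ N)) :=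
    SpecialLinearGroup.transvection (zero_ne_one : (0 : Fin 2) ≠ 1) (1 : ZMod (p ^ N)) with hTdef
  set H₁ : Subgroup SL(2, ZMod (p ^ N)) :=
    H.comap (SpecialLinearGroup.toGL : SL(2, ZMod (p ^ N)) →* _) with hH₁
  suffices h : H₁ = ⊤ by
    have hs : s ∈ H₁ := h ▸ Subgroup.mem_top s
    exact hs
  apply specialLinearGroup_eq_top_of_transvection_mem hN H₁ _ hT
  -- powers of `T` lie in `H`
  have hTm : ∀ m : ℕ, (SpecialLinearGroup.toGL (T ^ m) : GL (Fin 2) (ZMod (p ^ N))) ∈ H := by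
    intro m
    rw [map_pow]
    exact H.pow_mem hT m
  -- the reduction of `H₁` contains all elementary transvections, hence is everything
  have hS : H₁.map (SpecialLinearGroup.map (ZMod.castHom (dvd_pow_self p hN) (ZMod p))) = ⊤ := by
    apply specialLinearGroup_eq_top_of_transvections_mem
    · -- upper: reductions of powers of `T`
      intro c
      refine Subgroup.mem_map.mpr ⟨T ^ c.val, H₁.pow_mem hT _, ?_⟩
      rw [hTdef, transvection_pow, mul_one, map_transvection, map_natCast, ZMod.natCast_zmod_val]
    · -- lower: reductions of `x T^m x⁻¹` with `x ≡ J (mod p)`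
      intro c
      obtain ⟨x, hx, hxJ⟩ := hH ⟨!![0, -1; 1, 0], det_J⟩
      set m : ℕ := (-c).val with hm
      -- the conjugate, as an element of `SL₂`
      have hdet : Matrix.det ((x * SpecialLinearGroup.toGL (T ^ m) * x⁻¹ :
          GL (Fin 2) (ZMod (p ^ N))) : Matrix (Fin 2) (Fin 2) (ZMod (p ^ N))) = 1 := by
        rw [← GeneralLinearGroup.val_det_apply, map_mul, map_mul, map_inv, mul_inv_cancel_comm,
          GeneralLinearGroup.val_det_apply]
        exact (T ^ m).det_coe
      have hy : SpecialLinearGroup.toGL (⟨_, hdet⟩ : SL(2, ZMod (p ^ N))) =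
          x * SpecialLinearGroup.toGL (T ^ m) * x⁻¹ := Units.ext rfl
      refine Subgroup.mem_map.mpr ⟨⟨_, hdet⟩, ?_, ?_⟩
      · rw [hH₁, Subgroup.mem_comap, hy]
        exact H.mul_mem (H.mul_mem hx (hTm m)) (H.inv_mem hx)
      · -- its reduction is `J̄ T̄^m J̄⁻¹ = lower(-m) = lower(c)`
        apply SpecialLinearGroup.toGL_injective
        have h1 : SpecialLinearGroup.map (ZMod.castHom (dvd_pow_self p hN) (ZMod p)) (T ^ m) =
            SpecialLinearGroup.transvection (zero_ne_one : (0 : Fin 2) ≠ 1) (1 : ZMod p) ^ m := by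
          rw [map_pow, hTdef, map_transvection, map_one]
        rw [toGL_map, hy, map_mul, map_mul, map_inv, hxJ, ← toGL_map, h1,
          ← map_inv SpecialLinearGroup.toGL, ← map_mul, ← map_mul,
          J_mul_transvection_pow_mul_J_inv _ rfl, hm, ZMod.natCast_zmod_val, neg_neg]
  intro t
  have ht : t ∈ H₁.map (SpecialLinearGroup.map (ZMod.castHom (dvd_pow_self p hN) (ZMod p))) :=
    hS ▸ Subgroup.mem_top t
  exact Subgroup.mem_map.mp ht

/-- **Lifting with a transvection and the determinant.** For a prime `p`, `N ≠ 0` and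
`H ≤ GL₂(ℤ/p^N ℤ)` whose reduction modulo `p` contains `SL₂(𝔽_p)`, which contains
`T = (1 1; 0 1)`, and on which `det : H → (ℤ/p^N ℤ)ˣ` is onto, `H = GL₂(ℤ/p^N ℤ)`.
[cite: Lang1987, Ch. 17 §4, Lemma] -/
theorem generalLinearGroup_eq_top_of_transvection_mem (hN : N ≠ 0)
    (H : Subgroup (GL (Fin 2) (ZMod (p ^ N))))
    (hH : ∀ t : SL(2, ZMod p), ∃ h ∈ H,
      GeneralLinearGroup.map (ZMod.castHom (dvd_pow_self p hN) (ZMod p)) h =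
        (t : GL (Fin 2) (ZMod p)))
    (hT : ((SpecialLinearGroup.transvection (zero_ne_one : (0 : Fin 2) ≠ 1) (1 : ZMod (p ^ N)) :
      SL(2, ZMod (p ^ N))) : GL (Fin 2) (ZMod (p ^ N))) ∈ H)
    (hdet : ∀ u : (ZMod (p ^ N))ˣ, ∃ h ∈ H, GeneralLinearGroup.det h = u) : H = ⊤ := by
  rw [eq_top_iff]
  intro g _
  obtain ⟨h, hh, hdg⟩ := hdet (GeneralLinearGroup.det g)
  have h1 : Matrix.det ((h⁻¹ * g : GL (Fin 2) (ZMod (p ^ N))) :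
      Matrix (Fin 2) (Fin 2) (ZMod (p ^ N))) = 1 := by
    rw [← GeneralLinearGroup.val_det_apply, map_mul, map_inv, hdg, inv_mul_cancel, Units.val_one]
  have hmem := toGL_mem_of_transvection_mem hN H hH hT ⟨_, h1⟩
  have h2 : SpecialLinearGroup.toGL (⟨_, h1⟩ : SL(2, ZMod (p ^ N))) = h⁻¹ * g := Units.ext rfl
  have h3 : h⁻¹ * g ∈ H := h2 ▸ hmem
  simpa only [mul_inv_cancel_left] using H.mul_mem hh h3

/-- **The form used for the image of Galois, I: a conjugate of `T`.** For a prime `p`, `N ≠ 0`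
and `H ≤ GL₂(ℤ/p^N ℤ)` mapping onto `GL₂(𝔽_p)`, with `det : H → (ℤ/p^N ℤ)ˣ` onto, and
containing `g T g⁻¹` for some `g ∈ GL₂(ℤ/p^N ℤ)`, `H = GL₂(ℤ/p^N ℤ)` (apply
`generalLinearGroup_eq_top_of_transvection_mem` to `g⁻¹ H g`). [folklore] -/
theorem generalLinearGroup_eq_top_of_conj_transvection_mem (hN : N ≠ 0)
    (H : Subgroup (GL (Fin 2) (ZMod (p ^ N))))
    (hH : ∀ t : GL (Fin 2) (ZMod p), ∃ h ∈ H,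
      GeneralLinearGroup.map (ZMod.castHom (dvd_pow_self p hN) (ZMod p)) h = t)
    (hT : ∃ g : GL (Fin 2) (ZMod (p ^ N)),
      g * ((SpecialLinearGroup.transvection (zero_ne_one : (0 : Fin 2) ≠ 1) (1 : ZMod (p ^ N)) :
        SL(2, ZMod (p ^ N))) : GL (Fin 2) (ZMod (p ^ N))) * g⁻¹ ∈ H)
    (hdet : ∀ u : (ZMod (p ^ N))ˣ, ∃ h ∈ H, GeneralLinearGroup.det h = u) : H = ⊤ := by
  obtain ⟨g, hg⟩ := hT
  -- the conjugate subgroup `g⁻¹ H g`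
  set H' : Subgroup (GL (Fin 2) (ZMod (p ^ N))) := H.comap (MulAut.conj g).toMonoidHom with hH'
  have hmem : ∀ x, x ∈ H' ↔ g * x * g⁻¹ ∈ H := fun x ↦ Iff.rfl
  have hconj : ∀ y : GL (Fin 2) (ZMod (p ^ N)), g * (g⁻¹ * y * g) * g⁻¹ = y := fun y ↦ by group
  have htop : H' = ⊤ := by
    refine generalLinearGroup_eq_top_of_transvection_mem hN H' (fun t ↦ ?_) ((hmem _).mpr hg)
      (fun u ↦ ?_)
    · obtain ⟨h, hh, hht⟩ := hH
        (GeneralLinearGroup.map (ZMod.castHom (dvd_pow_self p hN) (ZMod p)) g *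
          (t : GL (Fin 2) (ZMod p)) *
          (GeneralLinearGroup.map (ZMod.castHom (dvd_pow_self p hN) (ZMod p)) g)⁻¹)
      refine ⟨g⁻¹ * h * g, (hmem _).mpr (by rw [hconj]; exact hh), ?_⟩
      rw [map_mul, map_mul, map_inv, hht]
      group
    · obtain ⟨h, hh, hhu⟩ := hdet u
      refine ⟨g⁻¹ * h * g, (hmem _).mpr (by rw [hconj]; exact hh), ?_⟩
      rw [map_mul, map_mul, map_inv, hhu, mul_assoc, mul_comm u, ← mul_assoc, inv_mul_cancel,
        one_mul]
  rw [eq_top_iff]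
  intro x _
  have hx : g⁻¹ * x * g ∈ H' := htop ▸ Subgroup.mem_top _
  rw [hmem, hconj] at hx
  exact hx

/-- **A unipotent element `u ≢ 1 (mod p)` with `(u - 1)² = 0` is conjugate to `T`** in
`GL₂(ℤ/p^N ℤ)`: `n = u - 1` has a unit off-diagonal entry, and `n P = P E₁₂` for the invertible
`P = (n e₂ | e₂)`, resp. `P = (n e₁ | e₁)`. [folklore] -/
theorem exists_conj_eq_of_unipotent (hN : N ≠ 0) (u : GL (Fin 2) (ZMod (p ^ N)))
    (hsq : ((u : Matrix (Fin 2) (Fin 2) (ZMod (p ^ N))) - 1) *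
      ((u : Matrix (Fin 2) (Fin 2) (ZMod (p ^ N))) - 1) = 0)
    (hne : ((u : Matrix (Fin 2) (Fin 2) (ZMod (p ^ N))) - 1).map
      (ZMod.castHom (dvd_pow_self p hN) (ZMod p)) ≠ 0) :
    ∃ g : GL (Fin 2) (ZMod (p ^ N)),
      g * ((SpecialLinearGroup.transvection (zero_ne_one : (0 : Fin 2) ≠ 1) (1 : ZMod (p ^ N)) :
        SL(2, ZMod (p ^ N))) : GL (Fin 2) (ZMod (p ^ N))) * g⁻¹ = u := by
  have hp : p.Prime := Fact.out
  set red := ZMod.castHom (dvd_pow_self p hN) (ZMod p) with hred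
  set n : Matrix (Fin 2) (Fin 2) (ZMod (p ^ N)) := (u : Matrix (Fin 2) (Fin 2) (ZMod (p ^ N))) - 1
    with hn
  have hu : (u : Matrix (Fin 2) (Fin 2) (ZMod (p ^ N))) = 1 + n := by rw [hn]; abel
  -- entries of `n² = 0`
  have h00 : n 0 0 * n 0 0 + n 0 1 * n 1 0 = 0 := by
    have := congrFun (congrFun hsq 0) 0
    simpa [Matrix.mul_apply, Fin.sum_univ_two] using this
  have h11 : n 1 0 * n 0 1 + n 1 1 * n 1 1 = 0 := by
    have := congrFun (congrFun hsq 1) 1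
    simpa [Matrix.mul_apply, Fin.sum_univ_two] using this
  have h01 : n 0 0 * n 0 1 + n 0 1 * n 1 1 = 0 := by
    have := congrFun (congrFun hsq 0) 1
    simpa [Matrix.mul_apply, Fin.sum_univ_two] using this
  have h10 : n 1 0 * n 0 0 + n 1 1 * n 1 0 = 0 := by
    have := congrFun (congrFun hsq 1) 0
    simpa [Matrix.mul_apply, Fin.sum_univ_two] using this
  -- one off-diagonal entry is a unit
  have hoff : red (n 0 1) ≠ 0 ∨ red (n 1 0) ≠ 0 := by
    by_contra hcon
    rw [not_or, not_not, not_not] at hcon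
    obtain ⟨h01', h10'⟩ := hcon
    apply hne
    have hd0 : red (n 0 0) = 0 := by
      have := congrArg red h00
      rw [map_add, map_mul, map_mul, h01', zero_mul, add_zero, map_zero, mul_self_eq_zero] at this
      exact this
    have hd1 : red (n 1 1) = 0 := by
      have := congrArg red h11
      rw [map_add, map_mul, map_mul, h01', mul_zero, zero_add, map_zero, mul_self_eq_zero] at this
      exact this
    ext i j
    fin_cases i <;> fin_cases j
    · exact hd0
    · exact h01'
    · exact h10'
    · exact hd1
  -- the transvection matrix
  have hTcoe : (((SpecialLinearGroup.transvection (zero_ne_one : (0 : Fin 2) ≠ 1)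
      (1 : ZMod (p ^ N)) : SL(2, ZMod (p ^ N))) : GL (Fin 2) (ZMod (p ^ N))) :
        Matrix (Fin 2) (Fin 2) (ZMod (p ^ N))) = 1 + !![0, 1; 0, 0] := by
    change ((SpecialLinearGroup.transvection (zero_ne_one : (0 : Fin 2) ≠ 1)
      (1 : ZMod (p ^ N)) : SL(2, ZMod (p ^ N))) : Matrix (Fin 2) (Fin 2) (ZMod (p ^ N))) = _
    rw [SpecialLinearGroup.transvection_coe, single_zero_one_eq]
  -- it suffices to find an invertible `P` with `n P = P E₁₂`
  suffices hP : ∃ P : GL (Fin 2) (ZMod (p ^ N)),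
      n * (P : Matrix (Fin 2) (Fin 2) (ZMod (p ^ N))) = (P : Matrix (Fin 2) (Fin 2) (ZMod (p ^ N))) *
        !![0, 1; 0, 0] by
    obtain ⟨P, hP⟩ := hP
    refine ⟨P, Units.ext ?_⟩
    rw [Units.val_mul, Units.val_mul, hTcoe, hu, mul_add, mul_one, add_mul, Units.mul_inv, ← hP,
      mul_assoc, Units.mul_inv, mul_one]
  rcases hoff with hu01 | hu10
  · -- `P = (n e₂ | e₂)`
    have hdet : IsUnit (Matrix.det !![n 0 1, 0; n 1 1, 1]) := by
      rw [Matrix.det_fin_two_of, mul_one, zero_mul, sub_zero]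
      exact isUnit_of_cast_ne_zero hN hu01
    refine ⟨Matrix.GeneralLinearGroup.mk'' _ hdet, ?_⟩
    change n * !![n 0 1, 0; n 1 1, 1] = !![n 0 1, 0; n 1 1, 1] * !![0, 1; 0, 0]
    ext i j
    fin_cases i <;> fin_cases j <;> simp [Matrix.mul_apply, Fin.sum_univ_two]
    · linear_combination h01
    · linear_combination h11
  · -- `P = (n e₁ | e₁)`
    have hdet : IsUnit (Matrix.det !![n 0 0, 1; n 1 0, 0]) := by
      rw [Matrix.det_fin_two_of, mul_zero, one_mul, zero_sub, IsUnit.neg_iff]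
      exact isUnit_of_cast_ne_zero hN hu10
    refine ⟨Matrix.GeneralLinearGroup.mk'' _ hdet, ?_⟩
    change n * !![n 0 0, 1; n 1 0, 0] = !![n 0 0, 1; n 1 0, 0] * !![0, 1; 0, 0]
    ext i j
    fin_cases i <;> fin_cases j <;> simp [Matrix.mul_apply, Fin.sum_univ_two]
    · linear_combination h00
    · linear_combination h10


/-- **The form used for the image of Galois, II: a unipotent element.** For a prime `p`,
`N ≠ 0` and `H ≤ GL₂(ℤ/p^N ℤ)` mapping onto `GL₂(𝔽_p)`, with `det : H → (ℤ/p^N ℤ)ˣ` onto, and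
containing an element `u` with `(u - 1)² = 0` and `u ≢ 1 (mod p)` (for the image of
`ρ̄_{E,p^N}`: the image of a generator of tame inertia at a multiplicative prime `ℓ ≠ p` at which
`ρ̄_{E,p}` is ramified), `H = GL₂(ℤ/p^N ℤ)`. [folklore] -/
theorem generalLinearGroup_eq_top_of_unipotent_mem (hN : N ≠ 0)
    (H : Subgroup (GL (Fin 2) (ZMod (p ^ N))))
    (hH : ∀ t : GL (Fin 2) (ZMod p), ∃ h ∈ H,
      GeneralLinearGroup.map (ZMod.castHom (dvd_pow_self p hN) (ZMod p)) h = t)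
    (hu : ∃ u ∈ H, ((u : Matrix (Fin 2) (Fin 2) (ZMod (p ^ N))) - 1) *
        ((u : Matrix (Fin 2) (Fin 2) (ZMod (p ^ N))) - 1) = 0 ∧
      ((u : Matrix (Fin 2) (Fin 2) (ZMod (p ^ N))) - 1).map
        (ZMod.castHom (dvd_pow_self p hN) (ZMod p)) ≠ 0)
    (hdet : ∀ u : (ZMod (p ^ N))ˣ, ∃ h ∈ H, GeneralLinearGroup.det h = u) : H = ⊤ := by
  obtain ⟨u, huH, hsq, hne⟩ := hu
  obtain ⟨g, hg⟩ := exists_conj_eq_of_unipotent hN u hsq hne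
  exact generalLinearGroup_eq_top_of_conj_transvection_mem hN H hH ⟨g, hg.symm ▸ huH⟩ hdet

end GeneralLinear

end Literature.NumberTheory.GaloisRepresentations.TransvectionLifting
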